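import Summits.QuantumFields.YangMills.Theorems.BalabanUVNodesN05SubBP2DK2PerKappaSlotExistsOfBindersPer
import Literature.MathematicalPhysics.QuantumFieldTheory.Balaban1983to89.B8SockSP5uNestedSrcPer
import Literature.MathematicalPhysics.QuantumFieldTheory.Balaban1983to89.B8Prop5ExistsZdLanPer
import Literature.MathematicalPhysics.QuantumFieldTheory.Balaban1983to89.B8Prop5UniqueZdLanPer
import Literature.MathematicalPhysics.QuantumFieldTheory.Balaban1983to89.B8LeafModelZd3SockPer

/-!
# BalabanUVNodes ∕ N05 ([Balaban1985RegularSpaces] Lemma 1 p. 79 – Thm 8 p. 101, Prop. 5 (1.107)–(1.109) p. 94, §3 p. 98, (1.3)–(1.5) p. 77, p. 77 «Ω_j ⊂ T_η»;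
# [Balaban1985BackgroundPropagators] Thm 3.1 p. 397, Thm 3.3 p. 399): (13)′β — THE WITNESS SLOT OF RECORD Slot8κ′ FROM NODE N06's PERIODIC BINDERS AND [4]'s PERIODIC
# LETTERS: Proposition 5's THREE inputs of (13)′α (`SP5u`, `p5ePer`, `p5uPer`) FED BY NAME from lit-balaban's IR-N05-P5NS servers (instance (ii) + currency 2)

Track A of `YM-PLAN.md` (cell `pub-ymgap`, HUMAN RULING D-0062), node **N05**; seat `pub-ymgap-dag-n05-d` (g15), 2026-08-28; bears on K1⁹ `stmt-QuantumFields-27364`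
(`--supports … --as helper`, count-neutral).  Edition β of the (13)′ junction: (13)′α `…K2PerKappaSlotExistsOfBindersPer.exists_residB8_slot8κ'_of_bindersPer_at` ∘
lit-balaban's LANDED Proposition-5 servers on the torus.

WHAT.  (13)′α displays, among the print ∕ [4] socket texts at the print-class periodic members, Proposition 5's uniqueness socket of Theorem 4's frame `SP5u` (dag-n05-c's (9′) text,
Theorem 8's source) and Proposition 5's existence ∕ uniqueness AS PRINTED at the periodic members of record `p5ePer ∕ p5uPer` (`lanOfRecordSubCκPer θ P Mκ Rκ (5dLB₈(1+11d²))`).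
HERE all three are FED BY NAME:
* `SP5u` := lit-balaban p21's ★★★ `B8SockSP5uNestedSrcPer.sockP5uSrcPer_of_lettersAtPerNested` (IR-N05-P5NS instance (ii), p661113) at `i := a.toZdIdx`, period `P`,
  `Φ := Site θ.D → θ.𝔸`, `Adm :=` the sourced admissibility of (9′)∕T6c (conjunct order `((InR ∧ sa ∧ supp ∧ Bdd) ∧ IsPeriodic) ∧ msup`), `LanF := LanF146 θ.L k η (Ω 0) Λs`,
  `src := fun φ => φ` — its two projections `⟨⟨h.1.1.2.2.2, h.2⟩, h.1.2⟩` ∕ `h.1` (dag-n05-c CHECK (ii) I.42442), its three member laws DISCHARGED from the index (`a.Ω_zero`,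
  `a.dvd`, the shift-invariance of `Λs k j` from `IdxB8SubDPer.isPeriodic_Λs` + `forall_shift_e_of_isPeriodic`), its own sourced b9 input := the displayed `SH59src` at
  threshold `c₅₉ := cP`; the server's member-uniform radius `c_u` and threshold `c_P⁵ᵘ` are absorbed (`cP ↦ min cP c_P⁵ᵘ` by antitonicity of the four socket texts).
* `p5ePer` := r05's ★★★ `B8Prop5ExistsZdLanPer.prop5Exists_zdLanPer_idxB8LanCκPer` (currency 2, p661913; `lanOfRecordSubCκPer` is its family by `rfl`), torus law `hΛ` DISCHARGED.
* `p5uPer` := p21's ★★★ `B8Prop5UniqueZdLanPer.prop5Unique_zdLanPer_of_lettersAtPerNested` (currency 2, p658676) at `ι := IdxB8LanCκPer.toZdLanIdx`, `p := fun _ => P`, its six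
  member laws DISCHARGED (`a.laws`, `a.periodic`, `a.mem.dvd`, `hΛ`).
DISPLAYED INSTEAD: [4]'s Proposition-5 letters at the periodic members of record `a : IdxB8LanCκPer θ P Mκ Rκ` in the RD currency — the EXISTENCE letters `SLet` (text of
p661913 VERBATIM) and the UNIQUENESS letters `SLetUB` (text of p658676 VERBATIM; the SAME family serves p21's instance-(ii) server at `⟨a, U₀⟩`), with their constants
`B₀′ᴴ, B₂′, B_G, B_R`, the regularity threshold `c_L` and the free-constant relation `3(2dL²)B_G B_R ≤ B₀′∕2` ((1.108)'s `B₀′` = the layer's free constant).  UNCHANGED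
from (13)′α: `SP5base ∕ SP5 ∕ SH59src` (servers: r05's E-ii stack E-ii-4∕5; n06-b FILE 7), N06's five analytic binders and the both-points socket per member, Proposition 6
in dag-n05-e's served shape, Theorem 8's constants OUTER with (8′)∕(9′)'s inequalities, the N06 pin as four equations.
WHAT IS PROVED (one theorem + one private index lemma; no estimate; no new definition): ★★★ `exists_residB8_slot8κ'_of_bindersPer_p5Letters_at` — at a given period `P`:
`∃ lam c₁ ρ₀ ax, 0 < c₁ ∧ 1 ≤ ρ₀ ∧ B8LeafOfRecordSubBP₂DPerκ θ P Mκ Rκ ⟨lam.cutSubBP₅κPer P Mκ Rκ c₁ ρ₀, ax⟩`.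
HONEST FRAMING: composition BY NAME; 0 estimates of Bałaban's ∕ [4]'s proved here; EVERY displayed letter ∕ binder ∕ socket ∕ `hP6`'s family remains a HYPOTHESIS of print's ∕ [4]'s
shape (N06's periodic letters `SLet ∕ SLetUB` and five analytic binders are NOT yet inhabited at every print-class periodic member); Proposition 7's slot junk-inhabited
(census, (10)′ A); count-neutral; **N05 NOT discharged** (director-ym №227 (b)); FLAG №4 OPEN; K1⁹ NOT claimed; Bałaban AS PRINTED (Thm 8 SURVIVING form, GAPS G-B8-13);
one finite 𝕋⁴ programme at fixed ε; nothing continuum ∕ ℝ⁴ ∕ OS ∕ mass-gap ∕ Clay.  No `sorry`, no new definition.  Unit `pub-ymgap-dag-n05-d` (g15).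
[cite: Balaban1985RegularSpaces, Lemma 1 p.79, Thm 2 p.83, Prop. 3 p.87, Thm 4 p.88, Prop. 5 (1.107)–(1.109) p.94, p.95, §3 p.98, Prop. 6 p.99, Prop. 7 p.100, Thm 8 (1.146) p.101, (1.3)–(1.5) p.77, p.77 («Ω_j ⊂ T_η»); Balaban1985BackgroundPropagators, Thm 3.1 p.397, Thms 3.2–3.3 pp.397–399, (3.42)–(3.47) p.398, Thm 3.11 p.416; Balaban1985Averaging, (4) p.18]
-/

noncomputable section

namespace Summit.QuantumFields.YangMills.BalabanUVNodes.N05SubBP2DK2PerKappaSlotExistsOfBindersPerP5Letters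

open Literature.MathematicalPhysics.QuantumFieldTheory.Balaban1983to89
open Literature.MathematicalPhysics.QuantumFieldTheory.Balaban1983to89.Node00
open Literature.MathematicalPhysics.QuantumFieldTheory.Balaban1983to89.B8IdxB8LawsB (IdxB8LawsB IdxB8SubB)
open Literature.MathematicalPhysics.QuantumFieldTheory.Balaban1983to89.B8LeafModelZd (ZdIdx)
open Literature.MathematicalPhysics.QuantumFieldTheory.Balaban1983to89.B8LeafModelZdHP2Per (zdGF3HP₂Per)
open Literature.MathematicalPhysics.QuantumFieldTheory.Balaban1983to89.B8TowerBondsPrinted (towerBondsP)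
open Literature.MathematicalPhysics.QuantumFieldTheory.Balaban1983to89.B8Lemma1NonAbelian (mulCfg)
open Literature.MathematicalPhysics.QuantumFieldTheory.Balaban1983to89.B8LanF146 (LanF146)
open Literature.MathematicalPhysics.QuantumFieldTheory.Balaban1983to89.B8Prop5LandauDataZdPer (zdLanPer)
open Literature.MathematicalPhysics.QuantumFieldTheory.Balaban1983to89.B8Prop5LandauDataZd (ZdLanIdx)
open Literature.MathematicalPhysics.QuantumFieldTheory.Balaban1983to89.B8LeafModelZd3SockH2Per (SockB9P3H2Per)
open Literature.MathematicalPhysics.QuantumFieldTheory.Balaban1983to89.B8LeafModelZd3SockPer (forall_shift_e_of_isPeriodic)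
open Literature.MathematicalPhysics.QuantumFieldTheory.Balaban1983to89.B9SupplySockB9P3ZdSrcPer (SrcAtIPer SrcHolderAtIH2Per)
open Literature.MathematicalPhysics.QuantumFieldTheory.Balaban1983to89.B9SupplySockB9P3ZdLetters (OpsZd)
open Literature.MathematicalPhysics.QuantumFieldTheory.Balaban1983to89.B9Eq327GreenZdHermPer (InvAtHIPer)
open Literature.MathematicalPhysics.QuantumFieldTheory.Balaban1983to89.B9SupplySockB9P3ZdPer (GlobAtIPer)
open Literature.MathematicalPhysics.QuantumFieldTheory.Balaban1983to89.B9SupplySockB9P3ZdH2Per (HolderAtIH2Per)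
open Literature.MathematicalPhysics.QuantumFieldTheory.Balaban1983to89.B9SupplySockB9P3ZdAllLettersZdPer (opsAllZdPer)
open Literature.MathematicalPhysics.QuantumFieldTheory.Balaban1983to89.B9Eq316AveragingTransposeZd (betaTau qQ)
open Literature.MathematicalPhysics.QuantumFieldTheory.Balaban1983to89.B8SockSP5uNestedSrcPer (sockP5uSrcPer_of_lettersAtPerNested)
open Literature.MathematicalPhysics.QuantumFieldTheory.Balaban1983to89.B8Prop5ExistsZdLanPer (prop5Exists_zdLanPer_idxB8LanCκPer)
open Literature.MathematicalPhysics.QuantumFieldTheory.Balaban1983to89.B8Prop5UniqueZdLanPer (prop5Unique_zdLanPer_of_lettersAtPerNested)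
open Summit.QuantumFields.YangMills.BalabanUVNodes.N05SubBP2DK2PerKappaSlotExistsOfBindersPer (exists_residB8_slot8κ'_of_bindersPer_at)
open T4TermwiseTorus (IsPeriodic)
open MatrixLog B7Prop1Explicit B7Prop2Explicit B7Prop1Local B7Eq92Concrete
open B8Ineq130 (tlo thi)
open B8Ineq132 (InAk covDerivFwd)
open B8Eq119TwistedAxial (Restr129 InAx bgT)
open B8Eq140Level (SideTouches)
open B8Eq138LandauZd (covLap covDivB QT logCfg InR138 IsLandau146W)
open B8Eq184Proof (gaugeExp cfgExp)
open B8Eq146AExpansion (iEta plaqCovDeriv)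
open B8Eq143PlaqExpansion (pdiv)
open B7Prop4GeneralLevels (linCovIter)
open B8Eq155JBound (Jcur wsup)
open B8ScaledSupNorm (bondNorm msup Bdd)
open B9Eq340HolderZd (hquot AdmPair)
open B7Eq78Linearization (zdBlocking QprimeIter)
open B8Eq1117Concrete (XSpace)
open B8Prop5ContractionKLevel (Bd2)
open B8LambdaSpaceKLevel (wt)

-- `Site` alone could resolve to the torus sites of `Setup.lean`; re-export the `ℤ^d` sites of `B7Prop1Explicit`.
export B7Prop1Explicit (Site)

section IndexLaw

variable {θ : Stage3Params} {P : ℕ}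

/-- **The torus law of the periodic (1.5)-index in [4]'s letter currency**: at a periodic member every top constraint set `Λs k j` (`j ≤ k`) is invariant under the period
shifts `+ (P∕θ.Lʲ) • e i` — dag-n05-w2's periodic towers `IdxB8SubDPer.isPeriodic_Λs` read one direction at a time (`forall_shift_e_of_isPeriodic`), `((P∕θ.Lʲ : ℕ) : ℤ) =
(P : ℤ)∕(θ.L : ℤ)ʲ`. [cite: Balaban1985RegularSpaces, (1.5) p.77, p.77 («Ω_j ⊂ T_η»), §3 p.98 (bookkeeping)] -/
theorem IdxB8SubDPer.Λs_add_div_smul_iff (a : IdxB8SubDPer θ P) {j : ℕ} (hj : j ≤ a.toZdIdx.k) (y : Site θ.D) (i : Fin θ.D) :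
    y + ((P : ℤ) / (θ.L : ℤ) ^ j) • e i ∈ a.toZdIdx.Λs a.toZdIdx.k j ↔ y ∈ a.toZdIdx.Λs a.toZdIdx.k j := by
  have h := forall_shift_e_of_isPeriodic (a.isPeriodic_Λs le_rfl hj) y i
  push_cast at h
  exact Iff.of_eq h

end IndexLaw

section BindersPerP5Letters

variable (θ : Stage3Params)

/-- ★★★ **THE WITNESS SLOT OF RECORD FROM NODE N06's PERIODIC BINDERS AND [4]'s PERIODIC PROPOSITION-5 LETTERS, AT A GIVEN PERIOD `P`** — (13)′α with `SP5u` := p21's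
`sockP5uSrcPer_of_lettersAtPerNested` (instance (ii)), `p5ePer` := r05's `prop5Exists_zdLanPer_idxB8LanCκPer`, `p5uPer` := p21's `prop5Unique_zdLanPer_of_lettersAtPerNested`
(currency 2), member laws from the index; displayed instead: the existence letters `SLet` and the uniqueness letters `SLetUB` at the periodic members of record; everything
else of (13)′α verbatim.
[cite: Balaban1985RegularSpaces, Lemma 1 – Thm 8 pp.79–101, Prop. 5 (1.107)–(1.109) p.94, §3 p.98, (1.3)–(1.5) p.77, p.77 («Ω_j ⊂ T_η»); Balaban1985BackgroundPropagators, Thm 3.1 p.397, Thm 3.3 p.399, (3.42)–(3.47) p.398, Thm 3.11 p.416] -/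
theorem exists_residB8_slot8κ'_of_bindersPer_p5Letters_at (hD : 2 ≤ θ.D) [FiniteDimensional ℝ θ.𝔸] (Mκ Rκ P : ℕ)
    -- NODE N06's GENUINE TORUS RECORD DATA: a faithful Hermitian tracial state `τ` with its Cauchy–Schwarz constant `C_τ`, the base letters `ops₀`, the block parameter `M ≥ 1`
    (τ : θ.𝔸 →ₗ[ℂ] ℂ) (hτp : ∀ a : θ.𝔸, a ≠ 0 → 0 < (τ (star a * a)).re) (hτt : ∀ a b : θ.𝔸, τ (a * b) = τ (b * a))
    (hτs : ∀ a : θ.𝔸, τ (star a) = starRingEnd ℂ (τ a)) {Cτ : ℝ} (hCτ : ∀ x y : θ.𝔸, |(τ (star x * y)).re| ≤ Cτ * ‖x‖ * ‖y‖)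
    (ops₀ : ℝ → ZdIdx θ.D θ.L → ℕ → OpsZd θ.D θ.𝔸) {M : ℝ} (hM1 : 1 ≤ M)
    -- NODE N06's BINDER CONSTANTS ([4] Thm 3.11's `a_I`, (3.47)'s `a_T, B₀ᴺ`, (3.45)'s `C_β`, the source binders' `a_S, c_S, c_Sβ`) — OUTER
    {aI aT aS B₀N Cβ cS cSβ : ℝ} (haI : 0 < aI) (haT : 0 < aT) (haS : 0 < aS) (hB₀N : 0 < B₀N) (hCβ : 0 < Cβ) (hcS : 0 ≤ cS) (hcSβ : 0 ≤ cSβ)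
    -- the primitive constants of the layer ([4] (3.40) `B₀` AS N06 SERVES IT, the free constant `B₀′` = (1.108)'s, the Hölder pair) — OUTER; `B₀`, `B₀β` PINNED to N06's expressions
    {B₀ B₀' B₀β β : ℝ} {len : Site θ.D → ℝ} (hB₀' : 0 < B₀')
    (hB₀eq : B₀ = max 1 (2 * B₀N * max 1 (qQ θ.D θ.L Cτ (betaTau τ) 1)))
    (hB₀βeq : B₀β = 2 * max 0 Cβ * max 1 (qQ θ.D θ.L Cτ (betaTau τ) 1))
    -- [4]'s PROPOSITION-5 LETTER CONSTANTS ((1.92)'s `B₀′ᴴ, B₂′`, (1.101)'s `B_G`, (1.98)'s `B_R`), the regularity threshold `c_L`, the free-constant relation of (1.108) — OUTER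
    {B₀'H B₂' BG BR cL : ℝ} (hB₀'H : 0 < B₀'H) (hB₂' : 0 ≤ B₂') (hBG : 0 ≤ BG) (hBR : 0 ≤ BR) (hcL : 0 < cL)
    (hfree : 3 * (2 * (θ.D : ℝ) * (θ.L : ℝ) ^ 2) * BG * BR ≤ B₀' / 2)
    -- PROPOSITION 6 IN dag-n05-e's SERVED SHAPE (`prop6Printed_zdCubP_γ_holds_record_dvd`): print cubes at `ρ₀`, constants `B₁⋆, c₁⋆` — OUTER, displayed
    {ρ₀ : ℕ} {B₁s c₁s : ℝ} (hρ₀ : 1 ≤ ρ₀) (hc₁s : 0 < c₁s)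
    (hP6 : ∀ {ι : Type} (f : ι → ZdIdx θ.D θ.L) (B₁'' c₁'' : ℝ), B₁s ≤ B₁'' → c₁'' ≤ c₁s →
      B8.Prop6Printed θ.D (θ.L : ℝ) B₁'' c₁'' (fun j => zdCubP θ.𝔸 θ.L ρ₀ (f j)))
    -- Theorem 8's constants — OUTER, with (8′)∕(9′)'s inequalities and `B₁⋆ ≤ 5dLB₈(1+11d²)`; `γ″`, `γβ` PINNED to N06's expressions; the both-points threshold `cP₃′` free;
    -- `cP` = the common threshold of the three displayed Thm-4-frame sockets (Prop. 5's uniqueness radius `c_u` and threshold are the server's, absorbed inside)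
    {cP cP3' γ₈ γ' γ'' γβ B₈ B₈β : ℝ} (hcP : 0 < cP) (hcP3' : 0 < cP3') (hγ₈ : 1 ≤ γ₈) (hγ' : 0 ≤ γ')
    (hγ''eq : γ'' = 2 * cS * γ₈ / max 1 (2 * B₀N * max 1 (qQ θ.D θ.L Cτ (betaTau τ) 1)))
    (hγβeq : γβ = (max 0 Cβ * cS / B₀N + cSβ) * γ₈)
    (hB : 2 ≤ 5 * (θ.D : ℝ) * θ.L * B₀) (hB₀8 : B₀ ≤ B₈)
    (hγB : 5 * (θ.D : ℝ) * θ.L * B₀ + 2 * (γ' * B₀) ≤ 5 * (θ.D : ℝ) * θ.L * B₈)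
    (hγB'' : 5 * (θ.D : ℝ) * θ.L * B₀ + 2 * (γ'' * B₀) ≤ 5 * (θ.D : ℝ) * θ.L * B₈)
    (hB8β : 5 * (θ.D : ℝ) * θ.L * B₀β + 2 * B₀β * (γ'' * B₀) + γβ ≤ 5 * (θ.D : ℝ) * θ.L * B₈β)
    (hB₁big : B₁s ≤ 5 * (θ.D : ℝ) * θ.L * B₈ * (1 + 11 * (θ.D : ℝ) ^ 2))
    -- THE SOURCED GUARDED SOCKETS OF THEOREM 4's FRAME AT (1.146) EXCEPT `SP5u` (dag-n05-c's (9′) texts VERBATIM, as in (10)′ A ∕ (13)′α),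
    -- at the PRINT-CLASS PERIODIC MEMBERS `a : IdxB8SubDPerκ θ P Mκ Rκ` (member `a.toZdIdx`, period `P`) — HYPOTHESES (servers: r05's E-ii stack for `SP5base ∕ SP5`, n06-b FILE 7 for `SH59src`)
    (SP5base : ∀ a : IdxB8SubDPerκ θ P Mκ Rκ, ∀ α₀ α₁ : ℝ, 0 < α₀ → 0 < α₁ → α₀ + α₁ ≤ cP →
      ∀ U₀ U' : Site θ.D → Fin θ.D → θ.𝔸ˣ, (∀ x κ, U₀ x κ ∈ unitaryUnits θ.𝔸) → (∀ x κ, U' x κ ∈ unitaryUnits θ.𝔸) →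
      IsPeriodic P U₀ → IsPeriodic P U' → ∀ φ : Site θ.D → θ.𝔸, (((InR138 θ.L a.toZdIdx.k a.toZdIdx.η (a.toZdIdx.Ω 0) (a.toZdIdx.Λs a.toZdIdx.k) U₀ φ ∧ (∀ x, IsSelfAdjoint (φ x)) ∧ (∀ x, x ∉ a.toZdIdx.Ω 0 → φ x = 0) ∧
          Bdd θ.L a.toZdIdx.k a.toZdIdx.η (-(2 : ℝ)) (fun j (x : Site θ.D) => x ∈ a.toZdIdx.Ω j) φ) ∧ IsPeriodic P φ) ∧
        msup θ.L a.toZdIdx.k a.toZdIdx.η (-(2 : ℝ)) (fun j (x : Site θ.D) => x ∈ a.toZdIdx.Ω j) φ < γ₈ * (α₀ + α₁)) →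
      InAk θ.L a.toZdIdx.k a.toZdIdx.η α₀ a.toZdIdx.Ω U₀ → InAk θ.L a.toZdIdx.k a.toZdIdx.η α₀ a.toZdIdx.Ω (mulCfg U' U₀) → (∀ m, m ≤ a.toZdIdx.k → InAx θ.L m (a.toZdIdx.Λs m) U₀ (mulCfg U' U₀)) →
      (∀ j, j ≤ a.toZdIdx.k → ∀ (z : Site θ.D) (μ : Fin θ.D),
        ((∀ x, InBox (tlo θ.L z j) (thi θ.L z j) x → x ∈ a.toZdIdx.Ω j) ∨ (∀ x, InBox (tlo θ.L (z + e μ) j) (thi θ.L (z + e μ) j) x → x ∈ a.toZdIdx.Ω j)) →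
        ‖(avgIter θ.L (mulCfg U' U₀) j z μ : θ.𝔸) - (avgIter θ.L U₀ j z μ : θ.𝔸)‖ ≤ α₁) →
      (∀ b ∈ {b : Site θ.D × Fin θ.D | SideTouches (a.toZdIdx.Ω 0) b.1 b.2}, ‖((U' b.1 b.2 : θ.𝔸ˣ) : θ.𝔸) - 1‖ ≤ α₁) →
      (∃ (v : Site θ.D → θ.𝔸ˣ) (la : Site θ.D → θ.𝔸), (∀ x, v x ∈ unitaryUnits θ.𝔸) ∧ (∀ x, x ∉ a.toZdIdx.Ω 0 → v x = 1) ∧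
        (∀ j, j ≤ 1 → ∀ b ∈ {b : Site θ.D × Fin θ.D | SideTouches (a.toZdIdx.Ω j) b.1 b.2}, (v b.1 : θ.𝔸) = ((gaugeExp la b.1 : θ.𝔸ˣ) : θ.𝔸) ∧
        (v (b.1 + e b.2) : θ.𝔸) = ((gaugeExp la (b.1 + e b.2) : θ.𝔸ˣ) : θ.𝔸)) ∧
        (∀ j, j ≤ 1 → ∀ b ∈ {b : Site θ.D × Fin θ.D | SideTouches (a.toZdIdx.Ω j) b.1 b.2},
        ‖la b.1‖ ≤ (8 * B₀' * (5 * (θ.D : ℝ) * θ.L * B₈) * (α₀ + α₁)) ∧ ((θ.L : ℝ) ^ j * a.toZdIdx.η) * ‖covDerivFwd a.toZdIdx.η U₀ b.2 la b.1‖ ≤ (8 * B₀' * (5 * (θ.D : ℝ) * θ.L * B₈) * (α₀ + α₁))) ∧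
        LanF146 θ.L a.toZdIdx.k a.toZdIdx.η (a.toZdIdx.Ω 0) a.toZdIdx.Λs U₀ φ 1 (mgauge U₀ v⁻¹ U') ∧ Restr129 θ.L 1 (a.toZdIdx.Λs 1) U₀ ((1 : Site θ.D → θ.𝔸ˣ) * v) ∧ IsPeriodic P v))
    (SP5 : ∀ a : IdxB8SubDPerκ θ P Mκ Rκ, ∀ α₀ α₁ : ℝ, 0 < α₀ → 0 < α₁ → α₀ + α₁ ≤ cP →
      ∀ U₀ U' : Site θ.D → Fin θ.D → θ.𝔸ˣ, (∀ x κ, U₀ x κ ∈ unitaryUnits θ.𝔸) → (∀ x κ, U' x κ ∈ unitaryUnits θ.𝔸) →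
      IsPeriodic P U₀ → IsPeriodic P U' → ∀ φ : Site θ.D → θ.𝔸, (((InR138 θ.L a.toZdIdx.k a.toZdIdx.η (a.toZdIdx.Ω 0) (a.toZdIdx.Λs a.toZdIdx.k) U₀ φ ∧ (∀ x, IsSelfAdjoint (φ x)) ∧ (∀ x, x ∉ a.toZdIdx.Ω 0 → φ x = 0) ∧
          Bdd θ.L a.toZdIdx.k a.toZdIdx.η (-(2 : ℝ)) (fun j (x : Site θ.D) => x ∈ a.toZdIdx.Ω j) φ) ∧ IsPeriodic P φ) ∧
        msup θ.L a.toZdIdx.k a.toZdIdx.η (-(2 : ℝ)) (fun j (x : Site θ.D) => x ∈ a.toZdIdx.Ω j) φ < γ₈ * (α₀ + α₁)) →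
      InAk θ.L a.toZdIdx.k a.toZdIdx.η α₀ a.toZdIdx.Ω U₀ → InAk θ.L a.toZdIdx.k a.toZdIdx.η α₀ a.toZdIdx.Ω (mulCfg U' U₀) → (∀ m, m ≤ a.toZdIdx.k → InAx θ.L m (a.toZdIdx.Λs m) U₀ (mulCfg U' U₀)) →
      (∀ j, j ≤ a.toZdIdx.k → ∀ (z : Site θ.D) (μ : Fin θ.D),
        ((∀ x, InBox (tlo θ.L z j) (thi θ.L z j) x → x ∈ a.toZdIdx.Ω j) ∨ (∀ x, InBox (tlo θ.L (z + e μ) j) (thi θ.L (z + e μ) j) x → x ∈ a.toZdIdx.Ω j)) →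
        ‖(avgIter θ.L (mulCfg U' U₀) j z μ : θ.𝔸) - (avgIter θ.L U₀ j z μ : θ.𝔸)‖ ≤ α₁) →
      (∀ b ∈ {b : Site θ.D × Fin θ.D | SideTouches (a.toZdIdx.Ω 0) b.1 b.2}, ‖((U' b.1 b.2 : θ.𝔸ˣ) : θ.𝔸) - 1‖ ≤ α₁) →
      (∀ m, 1 ≤ m → m < a.toZdIdx.k → ∀ (u₁ : Site θ.D → θ.𝔸ˣ) (U₁ : Site θ.D → Fin θ.D → θ.𝔸ˣ) (A : Site θ.D → Fin θ.D → θ.𝔸),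
        (∀ x, u₁ x ∈ unitaryUnits θ.𝔸) → (∀ x, x ∉ a.toZdIdx.Ω 0 → u₁ x = 1) → IsPeriodic P u₁ → IsPeriodic P U₁ → IsPeriodic P A →
        mgauge U₀ u₁ U₁ = U' → Restr129 θ.L m (a.toZdIdx.Λs m) U₀ u₁ →
        LanF146 θ.L a.toZdIdx.k a.toZdIdx.η (a.toZdIdx.Ω 0) a.toZdIdx.Λs U₀ φ m U₁ →
        (∀ j, j ≤ m → ∀ b ∈ {b : Site θ.D × Fin θ.D | SideTouches (a.toZdIdx.Ω j) b.1 b.2},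
        U₁ b.1 b.2 = cfgExp a.toZdIdx.η A b.1 b.2 ∧ IsSelfAdjoint (A b.1 b.2) ∧ ‖A b.1 b.2‖ ≤ (5 * (θ.D : ℝ) * θ.L * B₈ * (α₀ + α₁)) * ((θ.L : ℝ) ^ j * a.toZdIdx.η)⁻¹) →
        ∃ (v : Site θ.D → θ.𝔸ˣ) (la : Site θ.D → θ.𝔸), (∀ x, v x ∈ unitaryUnits θ.𝔸) ∧ (∀ x, x ∉ a.toZdIdx.Ω 0 → v x = 1) ∧
        (∀ j, j ≤ m + 1 → ∀ b ∈ {b : Site θ.D × Fin θ.D | SideTouches (a.toZdIdx.Ω j) b.1 b.2}, (v b.1 : θ.𝔸) = ((gaugeExp la b.1 : θ.𝔸ˣ) : θ.𝔸) ∧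
        (v (b.1 + e b.2) : θ.𝔸) = ((gaugeExp la (b.1 + e b.2) : θ.𝔸ˣ) : θ.𝔸)) ∧
        (∀ j, j ≤ m + 1 → ∀ b ∈ {b : Site θ.D × Fin θ.D | SideTouches (a.toZdIdx.Ω j) b.1 b.2},
        ‖la b.1‖ ≤ (8 * B₀' * (5 * (θ.D : ℝ) * θ.L * B₈) * (α₀ + α₁)) ∧ ((θ.L : ℝ) ^ j * a.toZdIdx.η) * ‖covDerivFwd a.toZdIdx.η U₀ b.2 la b.1‖ ≤ (8 * B₀' * (5 * (θ.D : ℝ) * θ.L * B₈) * (α₀ + α₁))) ∧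
        LanF146 θ.L a.toZdIdx.k a.toZdIdx.η (a.toZdIdx.Ω 0) a.toZdIdx.Λs U₀ φ (m + 1) (mgauge U₀ v⁻¹ U₁) ∧ Restr129 θ.L (m + 1) (a.toZdIdx.Λs (m + 1)) U₀ (u₁ * v) ∧ IsPeriodic P v))
    (SH59src : ∀ a : IdxB8SubDPerκ θ P Mκ Rκ, ∀ α₀ α₁ : ℝ, 0 < α₀ → 0 < α₁ → α₀ + α₁ ≤ cP →
      ∀ U₀ U' : Site θ.D → Fin θ.D → θ.𝔸ˣ, (∀ x κ, U₀ x κ ∈ unitaryUnits θ.𝔸) → (∀ x κ, U' x κ ∈ unitaryUnits θ.𝔸) →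
      IsPeriodic P U₀ → IsPeriodic P U' → ∀ φ : Site θ.D → θ.𝔸, (((InR138 θ.L a.toZdIdx.k a.toZdIdx.η (a.toZdIdx.Ω 0) (a.toZdIdx.Λs a.toZdIdx.k) U₀ φ ∧ (∀ x, IsSelfAdjoint (φ x)) ∧ (∀ x, x ∉ a.toZdIdx.Ω 0 → φ x = 0) ∧
          Bdd θ.L a.toZdIdx.k a.toZdIdx.η (-(2 : ℝ)) (fun j (x : Site θ.D) => x ∈ a.toZdIdx.Ω j) φ) ∧ IsPeriodic P φ) ∧
        msup θ.L a.toZdIdx.k a.toZdIdx.η (-(2 : ℝ)) (fun j (x : Site θ.D) => x ∈ a.toZdIdx.Ω j) φ < γ₈ * (α₀ + α₁)) →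
      InAk θ.L a.toZdIdx.k a.toZdIdx.η α₀ a.toZdIdx.Ω U₀ → InAk θ.L a.toZdIdx.k a.toZdIdx.η α₀ a.toZdIdx.Ω (mulCfg U' U₀) → (∀ m, m ≤ a.toZdIdx.k → InAx θ.L m (a.toZdIdx.Λs m) U₀ (mulCfg U' U₀)) →
      (∀ j, j ≤ a.toZdIdx.k → ∀ (z : Site θ.D) (μ : Fin θ.D),
        ((∀ x, InBox (tlo θ.L z j) (thi θ.L z j) x → x ∈ a.toZdIdx.Ω j) ∨ (∀ x, InBox (tlo θ.L (z + e μ) j) (thi θ.L (z + e μ) j) x → x ∈ a.toZdIdx.Ω j)) →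
        ‖(avgIter θ.L (mulCfg U' U₀) j z μ : θ.𝔸) - (avgIter θ.L U₀ j z μ : θ.𝔸)‖ ≤ α₁) →
      (∀ b ∈ {b : Site θ.D × Fin θ.D | SideTouches (a.toZdIdx.Ω 0) b.1 b.2}, ‖((U' b.1 b.2 : θ.𝔸ˣ) : θ.𝔸) - 1‖ ≤ α₁) →
      (∀ m, 1 ≤ m → m ≤ a.toZdIdx.k → ∀ (u : Site θ.D → θ.𝔸ˣ) (W : Site θ.D → Fin θ.D → θ.𝔸ˣ) (A' : Site θ.D → Fin θ.D → θ.𝔸),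
        (∀ x, u x ∈ unitaryUnits θ.𝔸) → IsPeriodic P u → IsPeriodic P W → IsPeriodic P A' →
        mgauge U₀ u W = U' → Restr129 θ.L m (a.toZdIdx.Λs m) U₀ u → LanF146 θ.L a.toZdIdx.k a.toZdIdx.η (a.toZdIdx.Ω 0) a.toZdIdx.Λs U₀ φ m W →
        (∀ y τ, IsSelfAdjoint (A' y τ)) →
        (∀ j, j ≤ m → ∀ y τ, SideTouches (a.toZdIdx.Ω j) y τ →
        W y τ = cfgExp a.toZdIdx.η A' y τ ∧ ‖A' y τ‖ ≤ (2 * (θ.L * (5 * (θ.D : ℝ) * θ.L * B₈ * (α₀ + α₁))) + 8 * (8 * B₀' * (5 * (θ.D : ℝ) * θ.L * B₈) * (α₀ + α₁))) * ((θ.L : ℝ) ^ j * a.toZdIdx.η)⁻¹) →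
        (∀ y τ, (∀ j, j ≤ m → ¬ SideTouches (a.toZdIdx.Ω j) y τ) → A' y τ = 0) →
        msup θ.L m a.toZdIdx.η (-(1 : ℝ)) (fun j (b : Site θ.D × Fin θ.D) => SideTouches (a.toZdIdx.Ω j) b.1 b.2) (fun b => A' b.1 b.2)
        ≤ B₀ * (bondNorm θ.L m a.toZdIdx.η (-(3 : ℝ)) a.toZdIdx.Ω (fun x μ => Jcur a.toZdIdx.η U₀ A' μ x)
        + wsup 1 (fun p : {p : ℕ × (Site θ.D × Fin θ.D) // p.1 ≤ m ∧ p.2 ∈ towerBondsP θ.L a.toZdIdx.Ω (a.toZdIdx.Λs m) p.1} =>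
        linCovIter θ.L U₀ (iEta a.toZdIdx.η A') p.1.1 p.1.2.1 p.1.2.2)) + γ' * B₀ * (α₀ + α₁) ∧
        msup θ.L m a.toZdIdx.η (-(2 : ℝ)) (fun j (t : Fin θ.D × Fin θ.D × Site θ.D) => SideTouches (a.toZdIdx.Ω j) t.2.2 t.2.1)
        (fun t => covDerivFwd a.toZdIdx.η U₀ t.1 (fun z => A' z t.2.1) t.2.2)
        ≤ B₀ * (bondNorm θ.L m a.toZdIdx.η (-(3 : ℝ)) a.toZdIdx.Ω (fun x μ => Jcur a.toZdIdx.η U₀ A' μ x)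
        + wsup 1 (fun p : {p : ℕ × (Site θ.D × Fin θ.D) // p.1 ≤ m ∧ p.2 ∈ towerBondsP θ.L a.toZdIdx.Ω (a.toZdIdx.Λs m) p.1} =>
        linCovIter θ.L U₀ (iEta a.toZdIdx.η A') p.1.1 p.1.2.1 p.1.2.2)) + γ' * B₀ * (α₀ + α₁)))
    -- NODE N06's FIVE ANALYTIC BINDERS PER MEMBER at the genuine torus record with print's class (1.31) — HYPOTHESES ([4] Thm 3.11, (3.47)@−3, (3.45), (3.42)₃∕(3.43);
    -- dag-n06-b `B9SupplySockB9P3ZdSrcPer` §5's displayed inputs VERBATIM at `ι := toZdIdx`, `p := fun _ => P`; N06's object layer inhabits them)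
    (hinv : ∀ a : IdxB8SubDPerκ θ P Mκ Rκ,
      InvAtHIPer P θ.L (opsAllZdPer τ θ.L P (fun k j => towerBondsP θ.L a.toZdIdx.Ω (a.toZdIdx.Λs k) j) ops₀) aI M a.toZdIdx a.toZdIdx.k)
    (hglob : ∀ a : IdxB8SubDPerκ θ P Mκ Rκ,
      GlobAtIPer P θ.L (opsAllZdPer τ θ.L P (fun k j => towerBondsP θ.L a.toZdIdx.Ω (a.toZdIdx.Λs k) j) ops₀) aT B₀N M a.toZdIdx a.toZdIdx.k)
    (hhol : ∀ a : IdxB8SubDPerκ θ P Mκ Rκ,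
      HolderAtIH2Per P θ.L (opsAllZdPer τ θ.L P (fun k j => towerBondsP θ.L a.toZdIdx.Ω (a.toZdIdx.Λs k) j) ops₀) aT Cβ β len M a.toZdIdx a.toZdIdx.k)
    (hsrc : ∀ a : IdxB8SubDPerκ θ P Mκ Rκ,
      SrcAtIPer P θ.L (opsAllZdPer τ θ.L P (fun k j => towerBondsP θ.L a.toZdIdx.Ω (a.toZdIdx.Λs k) j) ops₀) aS cS M a.toZdIdx a.toZdIdx.k)
    (hsrcH : ∀ a : IdxB8SubDPerκ θ P Mκ Rκ,
      SrcHolderAtIH2Per P θ.L (opsAllZdPer τ θ.L P (fun k j => towerBondsP θ.L a.toZdIdx.Ω (a.toZdIdx.Λs k) j) ops₀) aS cSβ β len M a.toZdIdx a.toZdIdx.k)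
    -- THE GUARDED BOTH-POINTS SOCKET OF PROPOSITION 3's FRAME per member at print's class, threshold `cP₃′` — HYPOTHESIS ([4] Thm 3.3 at periodic `U₀, W, A′`; dag-n05-w1's
    -- `SockB9P3H2Per`; NODE N06's to serve at print's class — LOCATED-JUNCTION-SHAPE)
    (SB9H2Per : ∀ a : IdxB8SubDPerκ θ P Mκ Rκ, SockB9P3H2Per (𝔸 := θ.𝔸) P θ.L B₀ B₀β cP3' β len a.toZdIdx.η a.toZdIdx.k a.toZdIdx.Ω a.toZdIdx.Λs
      (fun m l => towerBondsP θ.L a.toZdIdx.Ω (a.toZdIdx.Λs m) l))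
    -- [4]'s LETTERS FOR PROPOSITION 5 AT THE PERIODIC MEMBERS OF RECORD `a : IdxB8LanCκPer θ P Mκ Rκ` (print-class periodic member + unitary `P`-periodic
    -- background), RD currency: the EXISTENCE letters ((E1)∕(E2)∕(1.91) at periodic arguments, (P) laws; `B8Prop5ExistsZdLanPer`'s `SLet` VERBATIM) and the UNIQUENESS
    -- letters ((U1)∕(U2)∕(1.91) at periodic arguments, (P) laws; `B8Prop5UniqueZdLanPer`'s `SLetUBper` VERBATIM at `ι := toZdLanIdx`, `p := fun _ => P`) — HYPOTHESES
    -- ([Balaban1985BackgroundPropagators] Thm 3.1 p. 397, Thms 3.2–3.3; NODE N06's periodic letters to serve)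
    (SLet : ∀ a : IdxB8LanCκPer θ P Mκ Rκ, ∀ α₀ : ℝ, 0 < α₀ → α₀ ≤ cL → InAk θ.L a.toZdLanIdx.k a.toZdLanIdx.η α₀ a.toZdLanIdx.Ω a.toZdLanIdx.U₀ →
      ∃ (g Δ : (Site θ.D → θ.𝔸) →ₗ[ℂ] (Site θ.D → θ.𝔸)) (q : (Site θ.D → θ.𝔸) →ₗ[ℂ] (ℕ → Site θ.D → θ.𝔸)) (qs : (ℕ → Site θ.D → θ.𝔸) →ₗ[ℂ] (Site θ.D → θ.𝔸))
        (Aw c : (ℕ → Site θ.D → θ.𝔸) →ₗ[ℂ] (ℕ → Site θ.D → θ.𝔸)) (H' : XSpace θ.D a.toZdLanIdx.k θ.𝔸 →ₗ[ℂ] (Site θ.D → θ.𝔸)),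
        (∀ x, (∀ (z : Site θ.D) (i : Fin θ.D), x (z + (P : ℤ) • e i) = x z) → ∀ y ∈ a.toZdLanIdx.Ω 0, (Δ (g x) + qs (Aw (q (g x)))) y = x y) ∧
        (∀ f, (∀ (z : Site θ.D) (i : Fin θ.D), f (z + (P : ℤ) • e i) = f z) → q (g (g (qs (c (q f))))) = q f) ∧
        (∀ (f : Site θ.D → θ.𝔸) (z : Site θ.D) (i : Fin θ.D), g f (z + (P : ℤ) • e i) = g f z) ∧
        (∀ f : Site θ.D → θ.𝔸, (∀ (z : Site θ.D) (i : Fin θ.D), f (z + (P : ℤ) • e i) = f z) →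
          ∀ (z : Site θ.D) (i : Fin θ.D), qs (c (q f)) (z + (P : ℤ) • e i) = qs (c (q f)) z) ∧
        (∀ (f : Site θ.D → θ.𝔸), ∀ x ∈ a.toZdLanIdx.Ω 0, Δ f x = covLap a.toZdLanIdx.η a.toZdLanIdx.U₀ ((a.toZdLanIdx.Ω 0).indicator f) x) ∧
        (∀ (μ : ℕ → Site θ.D → θ.𝔸), ∀ x ∈ a.toZdLanIdx.Ω 0, qs μ x = QT θ.L a.toZdLanIdx.k a.toZdLanIdx.Λ a.toZdLanIdx.U₀ μ x) ∧
        (∀ (f : Site θ.D → θ.𝔸) (j : ℕ), j ≤ a.toZdLanIdx.k → ∀ y ∈ a.toZdLanIdx.Λ j, q f j y = QprimeIter (zdBlocking θ.D θ.L) (bgT θ.L a.toZdLanIdx.U₀) j f y) ∧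
        (∀ (X : XSpace θ.D a.toZdLanIdx.k θ.𝔸) (x : Site θ.D), ‖H' X x‖ ≤ B₀'H * ‖X‖) ∧
        (∀ j, j ≤ a.toZdLanIdx.k → ∀ (X : XSpace θ.D a.toZdLanIdx.k θ.𝔸), ∀ p ∈ {b : Site θ.D × Fin θ.D | SideTouches (a.toZdLanIdx.Ω j) b.1 b.2},
          wt θ.L a.toZdLanIdx.η j * ‖covDerivFwd a.toZdLanIdx.η a.toZdLanIdx.U₀ p.2 (H' X) p.1‖ ≤ B₀'H * ‖X‖) ∧
        (∀ X : XSpace θ.D a.toZdLanIdx.k θ.𝔸, Bd2 θ.L a.toZdLanIdx.η a.toZdLanIdx.k a.toZdLanIdx.Ω (covLap a.toZdLanIdx.η a.toZdLanIdx.U₀ (H' X)) (B₂' * ‖X‖)) ∧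
        (∀ (X : XSpace θ.D a.toZdLanIdx.k θ.𝔸) (x : Site θ.D), x ∉ a.toZdLanIdx.Ω 0 → H' X x = 0) ∧
        (∀ X Y : XSpace θ.D a.toZdLanIdx.k θ.𝔸, (∀ p, Y p = -star (X p)) → ∀ x, H' Y x = -star (H' X x)) ∧
        (∀ X : XSpace θ.D a.toZdLanIdx.k θ.𝔸, (∀ (b : Fin (a.toZdLanIdx.k + 1) × Site θ.D) (i : Fin θ.D), X (b.1, b.2 + ((P : ℤ) / (θ.L : ℤ) ^ (b.1 : ℕ)) • e i) = X b) →
          ∀ (z : Site θ.D) (i : Fin θ.D), H' X (z + (P : ℤ) • e i) = H' X z) ∧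
        (∀ (Y : XSpace θ.D a.toZdLanIdx.k θ.𝔸), (∀ (b : Fin (a.toZdLanIdx.k + 1) × Site θ.D) (i : Fin θ.D), Y (b.1, b.2 + ((P : ℤ) / (θ.L : ℤ) ^ (b.1 : ℕ)) • e i) = Y b) →
          ∀ (j : ℕ) (hj : j ≤ a.toZdLanIdx.k) (y : Site θ.D), y ∈ a.toZdLanIdx.Λ j →
          QprimeIter (zdBlocking θ.D θ.L) (bgT θ.L a.toZdLanIdx.U₀) j (H' Y) y = Y (⟨j, Nat.lt_succ_of_le hj⟩, y)) ∧
        (∀ (f : Site θ.D → θ.𝔸) (r : ℝ), 0 ≤ r → Bd2 θ.L a.toZdLanIdx.η a.toZdLanIdx.k a.toZdLanIdx.Ω f r →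
          (∀ x, ‖g f x‖ ≤ BG * r) ∧ ∀ j, j ≤ a.toZdLanIdx.k → ∀ p ∈ {b : Site θ.D × Fin θ.D | SideTouches (a.toZdLanIdx.Ω j) b.1 b.2},
            wt θ.L a.toZdLanIdx.η j * ‖covDerivFwd a.toZdLanIdx.η a.toZdLanIdx.U₀ p.2 (g f) p.1‖ ≤ BG * r) ∧
        (∀ (f : Site θ.D → θ.𝔸) (x : Site θ.D), x ∉ a.toZdLanIdx.Ω 0 → g f x = 0) ∧
        (∀ f : Site θ.D → θ.𝔸, (∀ j, j ≤ a.toZdLanIdx.k → ∀ x ∈ a.toZdLanIdx.Ω j, IsSelfAdjoint (f x)) → ∀ x, IsSelfAdjoint (g f x)) ∧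
        (∀ (f : Site θ.D → θ.𝔸) (r : ℝ), 0 ≤ r → Bd2 θ.L a.toZdLanIdx.η a.toZdLanIdx.k a.toZdLanIdx.Ω f r →
          Bd2 θ.L a.toZdLanIdx.η a.toZdLanIdx.k a.toZdLanIdx.Ω (f - g (qs (c (q (g f))))) (BR * r)) ∧
        (∀ f : Site θ.D → θ.𝔸, (∀ j, j ≤ a.toZdLanIdx.k → ∀ x ∈ a.toZdLanIdx.Ω j, IsSelfAdjoint (f x)) →
          ∀ j, j ≤ a.toZdLanIdx.k → ∀ x ∈ a.toZdLanIdx.Ω j, IsSelfAdjoint ((f - g (qs (c (q (g f))))) x)))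
    (SLetUB : ∀ a : IdxB8LanCκPer θ P Mκ Rκ, ∀ α₀ : ℝ, 0 < α₀ → α₀ ≤ cL → InAk θ.L a.toZdLanIdx.k a.toZdLanIdx.η α₀ a.toZdLanIdx.Ω a.toZdLanIdx.U₀ →
      ∃ (g Δ : (Site θ.D → θ.𝔸) →ₗ[ℂ] (Site θ.D → θ.𝔸)) (q : (Site θ.D → θ.𝔸) →ₗ[ℂ] (ℕ → Site θ.D → θ.𝔸)) (qs : (ℕ → Site θ.D → θ.𝔸) →ₗ[ℂ] (Site θ.D → θ.𝔸))
        (Aw c : (ℕ → Site θ.D → θ.𝔸) →ₗ[ℂ] (ℕ → Site θ.D → θ.𝔸)) (H' : XSpace θ.D a.toZdLanIdx.k θ.𝔸 →ₗ[ℂ] (Site θ.D → θ.𝔸)),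
        (∀ x : Site θ.D → θ.𝔸, (∀ (z : Site θ.D) (i : Fin θ.D), x (z + (P : ℤ) • e i) = x z) → (∃ C : ℝ, ∀ y, ‖x y‖ ≤ C) →
          g (Δ x + qs (Aw (q x))) = x) ∧
        (∀ φ : ℕ → Site θ.D → θ.𝔸, (∀ n, n ≤ a.toZdLanIdx.k → ∀ (y : Site θ.D) (i : Fin θ.D), φ n (y + ((P : ℤ) / (θ.L : ℤ) ^ n) • e i) = φ n y) →
          qs (c (q (g (g (qs φ))))) = qs φ) ∧
        (∀ (f : Site θ.D → θ.𝔸), ∀ x ∈ a.toZdLanIdx.Ω 0, Δ f x = covLap a.toZdLanIdx.η a.toZdLanIdx.U₀ ((a.toZdLanIdx.Ω 0).indicator f) x) ∧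
        (∀ (μ : ℕ → Site θ.D → θ.𝔸), ∀ x ∈ a.toZdLanIdx.Ω 0, qs μ x = QT θ.L a.toZdLanIdx.k a.toZdLanIdx.Λ a.toZdLanIdx.U₀ μ x) ∧
        (∀ (f : Site θ.D → θ.𝔸) (n : ℕ), n ≤ a.toZdLanIdx.k → ∀ y ∈ a.toZdLanIdx.Λ n, q f n y = QprimeIter (zdBlocking θ.D θ.L) (bgT θ.L a.toZdLanIdx.U₀) n f y) ∧
        (∀ (f : Site θ.D → θ.𝔸) (n : ℕ) (y : Site θ.D), ¬ (n ≤ a.toZdLanIdx.k ∧ y ∈ a.toZdLanIdx.Λ n) → q f n y = 0) ∧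
        (∀ (f : Site θ.D → θ.𝔸) (z : Site θ.D) (i : Fin θ.D), g f (z + (P : ℤ) • e i) = g f z) ∧
        (∀ μ : ℕ → Site θ.D → θ.𝔸, ∀ n, n ≤ a.toZdLanIdx.k → ∀ (y : Site θ.D) (i : Fin θ.D), Aw μ n (y + ((P : ℤ) / (θ.L : ℤ) ^ n) • e i) = Aw μ n y) ∧
        (∀ (X : XSpace θ.D a.toZdLanIdx.k θ.𝔸) (x : Site θ.D), ‖H' X x‖ ≤ B₀'H * ‖X‖) ∧
        (∀ n, n ≤ a.toZdLanIdx.k → ∀ (X : XSpace θ.D a.toZdLanIdx.k θ.𝔸), ∀ b ∈ {b : Site θ.D × Fin θ.D | SideTouches (a.toZdLanIdx.Ω n) b.1 b.2},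
          wt θ.L a.toZdLanIdx.η n * ‖covDerivFwd a.toZdLanIdx.η a.toZdLanIdx.U₀ b.2 (H' X) b.1‖ ≤ B₀'H * ‖X‖) ∧
        (∀ X : XSpace θ.D a.toZdLanIdx.k θ.𝔸, Bd2 θ.L a.toZdLanIdx.η a.toZdLanIdx.k a.toZdLanIdx.Ω (covLap a.toZdLanIdx.η a.toZdLanIdx.U₀ (H' X)) (B₂' * ‖X‖)) ∧
        (∀ X : XSpace θ.D a.toZdLanIdx.k θ.𝔸, (∀ (q : Fin (a.toZdLanIdx.k + 1) × Site θ.D) (i : Fin θ.D), X (q.1, q.2 + ((P : ℤ) / (θ.L : ℤ) ^ (q.1 : ℕ)) • e i) = X q) →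
          ∀ (z : Site θ.D) (i : Fin θ.D), H' X (z + (P : ℤ) • e i) = H' X z) ∧
        (∀ (Y : XSpace θ.D a.toZdLanIdx.k θ.𝔸), (∀ (q : Fin (a.toZdLanIdx.k + 1) × Site θ.D) (i : Fin θ.D), Y (q.1, q.2 + ((P : ℤ) / (θ.L : ℤ) ^ (q.1 : ℕ)) • e i) = Y q) →
          ∀ (n : ℕ) (hn : n ≤ a.toZdLanIdx.k) (y : Site θ.D), y ∈ a.toZdLanIdx.Λ n →
          QprimeIter (zdBlocking θ.D θ.L) (bgT θ.L a.toZdLanIdx.U₀) n (H' Y) y = Y (⟨n, Nat.lt_succ_of_le hn⟩, y)) ∧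
        (∀ (f : Site θ.D → θ.𝔸) (r : ℝ), 0 ≤ r → Bd2 θ.L a.toZdLanIdx.η a.toZdLanIdx.k a.toZdLanIdx.Ω f r →
          (∀ x, ‖g f x‖ ≤ BG * r) ∧ ∀ n, n ≤ a.toZdLanIdx.k → ∀ b ∈ {b : Site θ.D × Fin θ.D | SideTouches (a.toZdLanIdx.Ω n) b.1 b.2},
            wt θ.L a.toZdLanIdx.η n * ‖covDerivFwd a.toZdLanIdx.η a.toZdLanIdx.U₀ b.2 (g f) b.1‖ ≤ BG * r) ∧
        (∀ (f : Site θ.D → θ.𝔸) (r : ℝ), 0 ≤ r → Bd2 θ.L a.toZdLanIdx.η a.toZdLanIdx.k a.toZdLanIdx.Ω f r →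
          Bd2 θ.L a.toZdLanIdx.η a.toZdLanIdx.k a.toZdLanIdx.Ω (f - g (qs (c (q (g f))))) (BR * r))) :
    ∃ (lam : ResidB8 θ) (c₁ : ℝ) (ρ₀' : ℕ)
      (ax : ∀ j : IdxB8SubDPer θ P, (famB8OfRecordPer θ (lam.cutSubBP₅κPer P Mκ Rκ c₁ ρ₀').β (lam.cutSubBP₅κPer P Mκ Rκ c₁ ρ₀').len P j).Cfg →
        (famB8OfRecordPer θ (lam.cutSubBP₅κPer P Mκ Rκ c₁ ρ₀').β (lam.cutSubBP₅κPer P Mκ Rκ c₁ ρ₀').len P j).Pert →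
        (famB8OfRecordPer θ (lam.cutSubBP₅κPer P Mκ Rκ c₁ ρ₀').β (lam.cutSubBP₅κPer P Mκ Rκ c₁ ρ₀').len P j).Pert),
      0 < c₁ ∧ 1 ≤ ρ₀' ∧ B8LeafOfRecordSubBP₂DPerκ θ P Mκ Rκ ⟨lam.cutSubBP₅κPer P Mκ Rκ c₁ ρ₀', ax⟩ := by
  have hγ₈pos : 0 < γ₈ := lt_of_lt_of_le one_pos hγ₈
  have hB₀ : 0 < B₀ := by rw [hB₀eq]; exact lt_of_lt_of_le one_pos (le_max_left _ _)
  have h5 : 0 ≤ 5 * (θ.D : ℝ) * θ.L := by positivity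
  have hB8 : 2 ≤ 5 * (θ.D : ℝ) * θ.L * B₈ := hB.trans (mul_le_mul_of_nonneg_left hB₀8 h5)
  have hd2 : (0 : ℝ) ≤ 11 * (θ.D : ℝ) ^ 2 := by positivity
  have hB₁2 : 2 ≤ 5 * (θ.D : ℝ) * θ.L * B₈ * (1 + 11 * (θ.D : ℝ) ^ 2) :=
    hB8.trans (le_mul_of_one_le_right (le_trans zero_le_two hB8) (le_add_of_nonneg_right hd2))
  -- the torus law of the index in the letters' currency, at both indices
  have hΛκ : ∀ a : IdxB8SubDPerκ θ P Mκ Rκ, ∀ j, j ≤ a.toZdIdx.k → ∀ (y : Site θ.D) (i : Fin θ.D),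
      y + ((P : ℤ) / (θ.L : ℤ) ^ j) • e i ∈ a.toZdIdx.Λs a.toZdIdx.k j ↔ y ∈ a.toZdIdx.Λs a.toZdIdx.k j :=
    fun a j hj y i => IdxB8SubDPer.Λs_add_div_smul_iff a.1 hj y i
  have hΛκPer : ∀ a : IdxB8LanCκPer θ P Mκ Rκ, ∀ j, j ≤ a.toZdLanIdx.k → ∀ (y : Site θ.D) (i : Fin θ.D),
      y + ((P : ℤ) / (θ.L : ℤ) ^ j) • e i ∈ a.toZdLanIdx.Λ j ↔ y ∈ a.toZdLanIdx.Λ j :=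
    fun a j hj y i => IdxB8SubDPer.Λs_add_div_smul_iff a.mem.1 hj y i
  -- PROPOSITION 5's EXISTENCE (1.108) at the periodic members of record (r05's currency-2 theorem BY NAME)
  have p5ePer : B8.Prop5Exists B₀' (5 * (θ.D : ℝ) * θ.L * B₈ * (1 + 11 * (θ.D : ℝ) ^ 2))
      (lanOfRecordSubCκPer θ P Mκ Rκ (5 * (θ.D : ℝ) * θ.L * B₈ * (1 + 11 * (θ.D : ℝ) ^ 2))) :=
    prop5Exists_zdLanPer_idxB8LanCκPer θ hD θ.two_le_L hB₁2 hB₀' hB₀'H hB₂' hBG hBR hcL hfree hΛκPer SLet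
  -- PROPOSITION 5's UNIQUENESS (1.109) at the periodic members of record (p21's currency-2 theorem BY NAME), member laws from the index
  have p5uPer : B8.Prop5Unique (lanOfRecordSubCκPer θ P Mκ Rκ (5 * (θ.D : ℝ) * θ.L * B₈ * (1 + 11 * (θ.D : ℝ) ^ 2))) :=
    prop5Unique_zdLanPer_of_lettersAtPerNested (𝔸 := θ.𝔸) hD θ.two_le_L (le_trans zero_le_two hB₁2) hB₀'H hB₂' hBG hBR hcL
      (fun a : IdxB8LanCκPer θ P Mκ Rκ => a.toZdLanIdx) (fun _ => P) (fun a => a.laws.1) (fun a => a.laws.2.1) (fun a => a.laws.2.2.1)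
      (fun a => a.periodic) (fun a => by exact_mod_cast a.mem.dvd) hΛκPer SLetUB
  -- PROPOSITION 5's UNIQUENESS SOCKET OF THEOREM 4's FRAME `SP5u` (p21's instance-(ii) server BY NAME): radius `c_u`, threshold `c_P⁵ᵘ` member-uniform
  obtain ⟨cu, cPu, hcu, hcPu, HSP5u⟩ := sockP5uSrcPer_of_lettersAtPerNested (𝔸 := θ.𝔸) (B₀ := B₀) (B₀' := B₀') (B₈ := B₈) (γ := γ₈) (γ' := γ') (c59 := cP)
    hD θ.two_le_L hB8 hcL hB₀ hB₀' hB₀'H hB₂' hBG hBR hγ₈pos.le hγ' hB₀8 hγB hcP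
  have hmin₁ : min cP cPu ≤ cP := min_le_left _ _
  have hmin₂ : min cP cPu ≤ cPu := min_le_right _ _
  -- (13)′α at the common threshold `min cP c_P⁵ᵘ` (the four socket texts are antitone in the threshold)
  exact exists_residB8_slot8κ'_of_bindersPer_at θ hD Mκ Rκ P τ hτp hτt hτs hCτ ops₀ hM1 haI haT haS hB₀N hCβ hcS hcSβ hB₀' hB₀eq hB₀βeq hρ₀ hc₁s hP6
    (lt_min hcP hcPu) hcu hcP3' hγ₈ hγ' hγ''eq hγβeq hB hB₀8 hγB hγB'' hB8β hB₁big
    (fun a α₀ α₁ h₀ h₁ hs => SP5base a α₀ α₁ h₀ h₁ (hs.trans hmin₁))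
    (fun a α₀ α₁ h₀ h₁ hs => SP5 a α₀ α₁ h₀ h₁ (hs.trans hmin₁))
    (fun a α₀ α₁ h₀ h₁ hs => SH59src a α₀ α₁ h₀ h₁ (hs.trans hmin₁))
    (fun a α₀ α₁ h₀ h₁ hs => HSP5u a.toZdIdx P
      (fun φ U₀ a0 b0 => ((InR138 θ.L a.toZdIdx.k a.toZdIdx.η (a.toZdIdx.Ω 0) (a.toZdIdx.Λs a.toZdIdx.k) U₀ φ ∧ (∀ x, IsSelfAdjoint (φ x)) ∧
          (∀ x, x ∉ a.toZdIdx.Ω 0 → φ x = 0) ∧ Bdd θ.L a.toZdIdx.k a.toZdIdx.η (-(2 : ℝ)) (fun j (x : Site θ.D) => x ∈ a.toZdIdx.Ω j) φ) ∧ IsPeriodic P φ) ∧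
        msup θ.L a.toZdIdx.k a.toZdIdx.η (-(2 : ℝ)) (fun j (x : Site θ.D) => x ∈ a.toZdIdx.Ω j) φ < γ₈ * (a0 + b0))
      (fun U₀ φ m W => LanF146 θ.L a.toZdIdx.k a.toZdIdx.η (a.toZdIdx.Ω 0) a.toZdIdx.Λs U₀ φ m W) (fun φ => φ)
      (fun _ _ _ _ h => ⟨⟨h.1.1.2.2.2, h.2⟩, h.1.2⟩) (fun _ _ _ h => h.1) a.Ω_zero (by exact_mod_cast a.dvd) (hΛκ a)
      (fun α h0 hle U₀ hU₀ hper hIn => SLetUB ⟨a, U₀, hU₀, hper⟩ α h0 hle hIn) (SH59src a) α₀ α₁ h₀ h₁ (hs.trans hmin₂))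
    hinv hglob hhol hsrc hsrcH SB9H2Per p5ePer p5uPer

end BindersPerP5Letters

end Summit.QuantumFields.YangMills.BalabanUVNodes.N05SubBP2DK2PerKappaSlotExistsOfBindersPerP5Letters

end
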